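import Literature.Analysis.SegalBargmann.SchwartzCompactWeilDatum
import Literature.Analysis.SegalBargmann.SchwartzBargmannIntertwining
import Literature.Analysis.SegalBargmann.FockPlaceSubstitution
import Literature.NumberTheory.Weil1964.ArchPlacePhaseHom
import Literature.RepresentationTheory.KonnoKonno2007.JunctionVacuumDefinite
import HarnessLib

/-!
# A single-place compact factor of an archimedean Weil datum over several places acts on the place-free Fock
# vectors by ONE unitary character; at a definite unitary place the character is a power of `det`

Topic `NumberTheory/Weil1964`; namespace `Literature.NumberTheory.Weil1964`.  KERNEL ONLY: no `def … : Prop` record,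
no definition, no proof hole; every statement below is proved from the imported tree files.

Setting.  The archimedean index of a dual pair over a number field with real places `o` is `ι × o` (the tree's
`placeBlock` / `placePhase` / `piPhaseHom` convention of `ArchFollandCompact`, `ArchVacuumSectionPlaces`,
`ArchPlacePhaseHom`): the Schwartz space is `𝓢(ℝ^{ι × o})`, a Fock polynomial is `G ∈ ℂ[z_{(i,v)}]` and its Schwartz
vector is `binvPi G = B⁻¹G` (`SchwartzBargmannIntertwining`).  «`G` is FREE OF THE PLACE `v`» means
`∀ x ∈ G.vars, x.2 ≠ v` — `binvPi G` is the Gaussian in the variables of the slice `v` times an arbitrary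
polynomial-Gaussian in the variables of the other slices (e.g. a `K`-type vector at one place, the vacuum at `v`).

* §1 (polynomial algebra) a unitary block AT the place `v`, `placeBlock (Pi.mulSingle v A)`, fixes every place-`v`-free
  polynomial under the Bargmann substitution: `linSubst (star ↑(placeBlock (Pi.mulSingle v A))) G = G`
  (`linSubst_blockDiagonal_mulSingle` = `placeMap v`, which is the identity off the variables of `v`), hence
  **`unitaryOpPi_placeBlock_mulSingle_binvPi`**: `μ₀(placeBlock (Pi.mulSingle v A)) (B⁻¹G) = B⁻¹G`.
* §2 (abstract datum) **`IsArchWeilDatum.exists_character_placeBlock_mulSingle`**: if a subgroup `κ₀ : H →* G_∞`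
  (continuous) acts on phase space through unitary blocks at the place `v`,
  `ι𝕎 (κ₀ h) = realifySp (placeBlock (Pi.mulSingle v (ρ h)))`, then there is ONE continuous unitary character
  `χ : H →* S¹` with `ω (κ₀ h) (B⁻¹G) = χ h • B⁻¹G` for every `h` and every place-`v`-free `G` (and
  `ω (κ₀ h) h₀ = χ h • h₀`): the datum restricted to `H` IS `compactWeilRep _ χ`
  (`IsArchWeilDatum.exists_eq_compactWeilRep`, [Folland1989, Prop. (4.39)]) and §1.
* §3 (product junction) **`IsArchWeilDatum.exists_character_of_place`**: the same for
  `ι𝕎 = (piPhaseHom ε Φ).comp ϖ` (`ArchPlacePhaseHom`), a local compact datum `Φ v (κᵥ h) = realifySp (ιᵥ h)` at `v`,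
  and a continuous section `sec : H →* G_∞` with `ϖ (sec h) = Pi.mulSingle v (κᵥ h)` — by
  `piPhaseHom_mulSingle_eq_realifySp` (`reindexPhase_realify`, `realify_placeBlock`).
* §4 (Konno–Konno's real pairs, `V` DEFINITE at `v`) **`IsArchWeilDatum.exists_forall_place_binvPi_eq_det_zpow_smul`**:
  for the junctions `Φ v = ι𝕎 (P v) (Q v) (R v) (S v)` and a place `v` with `IsEmpty (P v) ∨ IsEmpty (Q v)`, along any
  continuous section `sec : U(P_v,Q_v) →* G_∞` over `g ↦ Pi.mulSingle v (g, 1)`: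
  `∃ m : ℤ, ∀ g, ∀ G free of v, ω (sec g) (B⁻¹G) = det(g)^m • B⁻¹G` (and the same on `h₀`) — the character of §3 on
  the compact `U(P_v) × U(Q_v) ↠ U(P_v,Q_v)` is a pair of determinant powers (`exists_vacExponents_of_continuous`,
  [BröckerTomDieck1985, II Prop. 8.1]) and the empty block contributes `det = 1`.

Compared with `KonnoKonno2007/JunctionVacuumDefinite` (one place, the Gaussian only) this is the SEVERAL-PLACES form
on ALL place-`v`-free Fock vectors, with no splitting `ι × o ≃ σ_v ⊕ σ_rest`, no transport and no auxiliary local datum.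

Use (Hodge-CM model-construction cell, BINDER-TRIAGE §61–§62, ticket D-5 (c5) = (C-fix∞⊥), follow-on D-5e): with the
(J-arch) datum `IsArchWeilDatum (archPairPhaseHom …) (repTransport e_D archWeilRep)` of the census kit (whose phase
homomorphism IS `(piPhaseHom ε Φ).comp ϖ`) this gives, at every archimedean place `b` where the hermitian space is
definite, ONE integer `m_b` with `ω (u_b, 1) (B⁻¹G) = det(u_b)^{m_b} • B⁻¹G` for all `u_b ∈ U(V_b)` and all test vectors
that are the vacuum at `b` — the input shape of `GelbartRogawski1991/CompatibleSplittingTwistVacuumShift`.  Nothing here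
is a claim of the manuscripts adjudicated by that cell.

References (provenance; nothing is cited as a hypothesis): [Folland1989] G. B. Folland, *Harmonic Analysis in Phase
Space*, Princeton UP (1989), §1.7, Prop. (4.39), §4.2 (4.23); [Weil1964] A. Weil, *Sur certains groupes d'opérateurs
unitaires*, Acta Math. 111 (1964), Chap. I n° 12, Chap. III n° 37; [BröckerTomDieck1985] T. Bröcker, T. tom Dieck,
*Representations of compact Lie groups*, GTM 98, Ch. II Prop. 8.1; [KonnoKonno2007] K. Konno, T. Konno, Kyushu J.
Math. 61 (2007), §3.1 (3.1).
-/

set_option autoImplicit false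

noncomputable section

open Complex SchwartzMap Matrix MvPolynomial
open Literature.Analysis.SegalBargmann Literature.RepresentationTheory.HeisenbergGroup
open Literature.RepresentationTheory Literature.RepresentationTheory.KonnoKonno2007
open Literature.RepresentationTheory.KonnoKonno2007.RealDualPair

namespace Literature.NumberTheory.Weil1964

variable {ι : Type} [Fintype ι] [DecidableEq ι] {o : Type} [Fintype o] [DecidableEq o]

/-! ## §1 A unitary block at one place fixes the place-free Fock polynomials -/

section Polynomial

/-- the matrix of `placeBlock (Pi.mulSingle v A)` is `blockDiagonal (Pi.mulSingle v ↑A)`. [folklore] -/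
theorem coe_placeBlock_mulSingle (v : o) (A : Matrix.unitaryGroup ι ℂ) :
    ((placeBlock (Pi.mulSingle v A) : Matrix.unitaryGroup (ι × o) ℂ) : Matrix (ι × o) (ι × o) ℂ) =
      Matrix.blockDiagonal (Pi.mulSingle v (A : Matrix ι ι ℂ)) := by
  rw [coe_placeBlock]
  congr 1
  funext w
  by_cases hw : w = v
  · subst hw
    rw [Pi.mulSingle_eq_same, Pi.mulSingle_eq_same]
  · rw [Pi.mulSingle_eq_of_ne hw, Pi.mulSingle_eq_of_ne hw]
    rfl

/-- … and its adjoint is `blockDiagonal (Pi.mulSingle v (star ↑A))`. [folklore] -/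
theorem star_coe_placeBlock_mulSingle (v : o) (A : Matrix.unitaryGroup ι ℂ) :
    star ((placeBlock (Pi.mulSingle v A) : Matrix.unitaryGroup (ι × o) ℂ) : Matrix (ι × o) (ι × o) ℂ) =
      Matrix.blockDiagonal (Pi.mulSingle v (star (A : Matrix ι ι ℂ))) := by
  rw [coe_placeBlock_mulSingle, star_blockDiagonal]
  congr 1
  funext w
  by_cases hw : w = v
  · subst hw
    rw [Pi.mulSingle_eq_same, Pi.mulSingle_eq_same]
  · rw [Pi.mulSingle_eq_of_ne hw, Pi.mulSingle_eq_of_ne hw, star_one]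

omit [Fintype ι] [DecidableEq ι] [Fintype o] [DecidableEq o] in
/-- **`placeMap v ψ` is the identity on the polynomials free of the place `v`.** [folklore] -/
theorem placeMap_eq_self_of_vars (v : o) (ψ : MvPolynomial ι ℂ →ₐ[ℂ] MvPolynomial ι ℂ)
    {G : MvPolynomial (ι × o) ℂ} (hG : ∀ x ∈ G.vars, x.2 ≠ v) : placeMap v ψ G = G := by
  have h := MvPolynomial.hom_congr_vars (f₁ := (placeMap v ψ : MvPolynomial (ι × o) ℂ →+* MvPolynomial (ι × o) ℂ))
    (f₂ := RingHom.id (MvPolynomial (ι × o) ℂ)) (p₁ := G) (p₂ := G)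
    (RingHom.ext fun r => by
      rw [RingHom.comp_apply, RingHom.comp_apply, RingHom.coe_coe, MvPolynomial.algHom_C, RingHom.id_apply,
        MvPolynomial.algebraMap_eq])
    (fun x hx _ => by
      rw [RingHom.coe_coe, placeMap_X, if_neg (hG x hx), RingHom.id_apply]) rfl
  rwa [RingHom.coe_coe, RingHom.id_apply] at h

/-- **A unitary block at the place `v` fixes every place-`v`-free polynomial under the Bargmann substitution.**
[cite: Folland1989, Prop (4.39)] -/
theorem linSubst_star_placeBlock_mulSingle_of_vars (v : o) (A : Matrix.unitaryGroup ι ℂ)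
    {G : MvPolynomial (ι × o) ℂ} (hG : ∀ x ∈ G.vars, x.2 ≠ v) :
    linSubst (star ((placeBlock (Pi.mulSingle v A) : Matrix.unitaryGroup (ι × o) ℂ) : Matrix (ι × o) (ι × o) ℂ)) G =
      G := by
  rw [star_coe_placeBlock_mulSingle, linSubst_blockDiagonal_mulSingle, placeMap_eq_self_of_vars v _ hG]

/-- **… hence `μ₀(placeBlock (Pi.mulSingle v A)) (B⁻¹G) = B⁻¹G`**: the metaplectic operator of a unitary at the place
`v` fixes the Schwartz vectors that are the vacuum in the variables of `v`. [cite: Folland1989, Prop (4.39)] -/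
theorem unitaryOpPi_placeBlock_mulSingle_binvPi (v : o) (A : Matrix.unitaryGroup ι ℂ)
    {G : MvPolynomial (ι × o) ℂ} (hG : ∀ x ∈ G.vars, x.2 ≠ v) :
    unitaryOpPi (placeBlock (Pi.mulSingle v A)) (binvPi G) = binvPi G := by
  rw [unitaryOpPi_binvPi, linSubst_star_placeBlock_mulSingle_of_vars v A hG]

omit [Fintype ι] [Fintype o] in
/-- the renamed image of a one-place polynomial at another place `w ≠ v` is free of `v`. [folklore] -/
theorem vars_rename_atPlace_ne {v w : o} (h : w ≠ v) (p : MvPolynomial ι ℂ) :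
    ∀ x ∈ (rename (atPlace w) p).vars, x.2 ≠ v := by
  intro x hx
  obtain ⟨i, -, rfl⟩ := Finset.mem_image.1 (vars_rename (atPlace w) p hx)
  exact h

end Polynomial

/-! ## §2 An abstract datum restricted to unitary blocks at one place -/

section Datum

variable {Gtot : Type*} [Group Gtot] [TopologicalSpace Gtot] {H : Type*} [Group H] [TopologicalSpace H]

/-- **One unitary character on the place-free Fock vectors.**  If `κ₀ : H →* G_∞` is continuous and acts on phase
space through unitary blocks at the place `v` (`ι𝕎 (κ₀ h) = realifySp (placeBlock (Pi.mulSingle v (ρ h)))`), then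
for ONE continuous `χ : H →* S¹`: `ω (κ₀ h) h₀ = χ h • h₀` and `ω (κ₀ h) (B⁻¹G) = χ h • B⁻¹G` for every `h` and every
polynomial `G` free of the place `v` (dot-notation extension of `IsArchWeilDatum` from this directory, as
`SchwartzCompactWeilDatum` does). [cite: Folland1989, Prop (4.39)] -/
theorem IsArchWeilDatum.exists_character_placeBlock_mulSingle
    {ι𝕎 : Gtot →* symplecticGroup (polar (dotPairing (ι × o)))}
    {ω : Representation ℂ Gtot (SchwartzMap (ι × o → ℝ) ℂ)} (hW : IsArchWeilDatum ι𝕎 ω) (v : o)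
    (κ₀ : H →* Gtot) (hκ₀ : Continuous κ₀) (ρ : H →* Matrix.unitaryGroup ι ℂ)
    (hcomp : ∀ h, ι𝕎 (κ₀ h) = realifySp (ι × o) (placeBlock (Pi.mulSingle v (ρ h)))) :
    ∃ χ : H →* Circle, Continuous χ ∧
      (∀ h, ω (κ₀ h) (hermitePi 0) = ((χ h : Circle) : ℂ) • hermitePi 0) ∧
      ∀ (h : H) (G : MvPolynomial (ι × o) ℂ), (∀ x ∈ G.vars, x.2 ≠ v) →
        ω (κ₀ h) (binvPi G) = ((χ h : Circle) : ℂ) • binvPi G := by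
  let ιK : H →* Matrix.unitaryGroup (ι × o) ℂ :=
    placeBlockHom.comp ((MonoidHom.mulSingle (fun _ : o => Matrix.unitaryGroup ι ℂ) v).comp ρ)
  have hιK : ∀ h, ιK h = placeBlock (Pi.mulSingle v (ρ h)) := fun _ => rfl
  obtain ⟨χ, hχ, hωχ⟩ := hW.exists_eq_compactWeilRep κ₀ hκ₀ ιK fun h => by rw [hιK, hcomp]
  refine ⟨χ, hχ, fun h => ?_, fun h G hG => ?_⟩
  · rw [hωχ, compactWeilRep_hermitePi_zero]
  · rw [hωχ, compactWeilRep_binvPi, hιK, linSubst_star_placeBlock_mulSingle_of_vars v (ρ h) hG]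

end Datum

/-! ## §3 The product-of-places junction `piPhaseHom` -/

section Places

variable {σ : o → Type*} [∀ v, Fintype (σ v)] [∀ v, DecidableEq (σ v)] {Gv : o → Type*} [∀ v, Group (Gv v)]

/-- the unit of the symplectic group acts as `realify 1`. [folklore] -/
theorem coe_one_symplecticGroup_eq_realify_one {τ : Type*} [Fintype τ] [DecidableEq τ] :
    (⇑((1 : symplecticGroup (polar (dotPairing τ))).1 : ((τ → ℝ) × (τ → ℝ)) ≃ₗ[ℝ] ((τ → ℝ) × (τ → ℝ))) :
        PhaseMap τ) =
      realify (1 : Matrix.unitaryGroup τ ℂ) := by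
  rw [← coe_realifySp, map_one]

/-- **A single-place element whose local phase map is a realified unitary acts, through `piPhaseHom`, as the realified
unitary block at that place.** [cite: Weil1964, Chap. I n° 12, p. 160] -/
theorem piPhaseHom_mulSingle_eq_realifySp (ε : ∀ v, ι ≃ σ v)
    (Φ : ∀ v, Gv v →* symplecticGroup (polar (dotPairing (σ v)))) (v : o) {g : Gv v}
    {U : Matrix.unitaryGroup (σ v) ℂ} (hg : Φ v g = realifySp (σ v) U) :
    piPhaseHom ε Φ (Pi.mulSingle v g) =
      realifySp (ι × o) (placeBlock (Pi.mulSingle v (reindexUnitary (ε v) U))) := by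
  refine Subtype.ext (LinearEquiv.ext fun pq => ?_)
  change (⇑((piPhaseHom ε Φ (Pi.mulSingle v g)).1 :
      ((ι × o → ℝ) × (ι × o → ℝ)) ≃ₗ[ℝ] ((ι × o → ℝ) × (ι × o → ℝ))) : PhaseMap (ι × o)) pq =
    (⇑((realifySp (ι × o) (placeBlock (Pi.mulSingle v (reindexUnitary (ε v) U)))).1 :
      ((ι × o → ℝ) × (ι × o → ℝ)) ≃ₗ[ℝ] ((ι × o → ℝ) × (ι × o → ℝ))) : PhaseMap (ι × o)) pq
  rw [coe_piPhaseHom, coe_realifySp, realify_placeBlock]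
  congr 1
  funext w
  by_cases hw : w = v
  · subst hw
    rw [Pi.mulSingle_eq_same, Pi.mulSingle_eq_same, hg, coe_realifySp, reindexPhase_realify]
  · rw [Pi.mulSingle_eq_of_ne hw, Pi.mulSingle_eq_of_ne hw, map_one, coe_one_symplecticGroup_eq_realify_one,
      reindexPhase_realify, map_one]

variable {Gtot : Type*} [Group Gtot] [TopologicalSpace Gtot] {H : Type*} [Group H] [TopologicalSpace H]

/-- **One character per compact place factor of a datum over the product junction.**  For
`ι𝕎 = (piPhaseHom ε Φ).comp ϖ`, a local compact datum `Φ v (κᵥ h) = realifySp (ιᵥ h)` at the place `v` and a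
continuous section `sec : H →* G_∞` with `ϖ (sec h) = Pi.mulSingle v (κᵥ h)`: ONE continuous `χ : H →* S¹` with
`ω (sec h) h₀ = χ h • h₀` and `ω (sec h) (B⁻¹G) = χ h • B⁻¹G` for all `h` and all `G` free of `v`.
[cite: Folland1989, Prop (4.39); Weil1964, Chap. I n° 12] -/
theorem IsArchWeilDatum.exists_character_of_place (ε : ∀ v, ι ≃ σ v)
    (Φ : ∀ v, Gv v →* symplecticGroup (polar (dotPairing (σ v)))) (ϖ : Gtot →* ∀ v, Gv v)
    {ω : Representation ℂ Gtot (SchwartzMap (ι × o → ℝ) ℂ)} (hW : IsArchWeilDatum ((piPhaseHom ε Φ).comp ϖ) ω)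
    (v : o) (κv : H →* Gv v) (ιv : H →* Matrix.unitaryGroup (σ v) ℂ) (hv : ∀ h, Φ v (κv h) = realifySp (σ v) (ιv h))
    (sec : H →* Gtot) (hsec : Continuous sec) (hϖ : ∀ h, ϖ (sec h) = Pi.mulSingle v (κv h)) :
    ∃ χ : H →* Circle, Continuous χ ∧
      (∀ h, ω (sec h) (hermitePi 0) = ((χ h : Circle) : ℂ) • hermitePi 0) ∧
      ∀ (h : H) (G : MvPolynomial (ι × o) ℂ), (∀ x ∈ G.vars, x.2 ≠ v) →
        ω (sec h) (binvPi G) = ((χ h : Circle) : ℂ) • binvPi G :=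
  hW.exists_character_placeBlock_mulSingle v sec hsec ((reindexUnitary (ε v)).comp ιv) fun h => by
    rw [MonoidHom.comp_apply, hϖ h, piPhaseHom_mulSingle_eq_realifySp ε Φ v (hv h), MonoidHom.comp_apply]

end Places

/-! ## §4 Konno–Konno's real pairs at every place; `V` definite at the place `v` -/

section Definite

variable {P Q R S : o → Type*} [∀ v, Fintype (P v)] [∀ v, DecidableEq (P v)] [∀ v, Fintype (Q v)]
  [∀ v, DecidableEq (Q v)] [∀ v, Fintype (R v)] [∀ v, DecidableEq (R v)] [∀ v, Fintype (S v)]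
  [∀ v, DecidableEq (S v)]
variable {Gtot : Type*} [Group Gtot] [TopologicalSpace Gtot]

/-- **The compact factor `K_{V,v} = U(P_v) × U(Q_v)` of the product junction of Konno–Konno's real pairs acts on
the place-`v`-free Fock vectors by ONE continuous unitary character** (no definiteness needed), along any continuous
section `sec` over `k ↦ Pi.mulSingle v (kV k, 1)`. [cite: KonnoKonno2007, §3.1 (3.1); Folland1989, Prop (4.39)] -/
theorem IsArchWeilDatum.exists_character_kV_of_place (ε : ∀ v, ι ≃ DPIdx (P v) (Q v) (R v) (S v))
    (ϖ : Gtot →* ∀ v, Ginf (P v) (Q v) (R v) (S v)) {ω : Representation ℂ Gtot (SchwartzMap (ι × o → ℝ) ℂ)}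
    (hW : IsArchWeilDatum ((piPhaseHom ε fun v => ι𝕎 (P v) (Q v) (R v) (S v)).comp ϖ) ω) (v : o)
    (sec : Matrix.unitaryGroup (P v) ℂ × Matrix.unitaryGroup (Q v) ℂ →* Gtot) (hsec : Continuous sec)
    (hϖ : ∀ k, ϖ (sec k) = Pi.mulSingle v ((UForm.kV (P v) (Q v) k, 1) : Ginf (P v) (Q v) (R v) (S v))) :
    ∃ χ : Matrix.unitaryGroup (P v) ℂ × Matrix.unitaryGroup (Q v) ℂ →* Circle, Continuous χ ∧
      (∀ k, ω (sec k) (hermitePi 0) = ((χ k : Circle) : ℂ) • hermitePi 0) ∧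
      ∀ (k : Matrix.unitaryGroup (P v) ℂ × Matrix.unitaryGroup (Q v) ℂ) (G : MvPolynomial (ι × o) ℂ),
        (∀ x ∈ G.vars, x.2 ≠ v) → ω (sec k) (binvPi G) = ((χ k : Circle) : ℂ) • binvPi G :=
  hW.exists_character_of_place ε (fun v => ι𝕎 (P v) (Q v) (R v) (S v)) ϖ v
    ((MonoidHom.inl (UForm (P v) (Q v)) (UForm (R v) (S v))).comp (UForm.kV (P v) (Q v)))
    (dualPairι.comp (MonoidHom.inl _ (Matrix.unitaryGroup (R v) ℂ × Matrix.unitaryGroup (S v) ℂ)))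
    (fun k => by
      rw [MonoidHom.comp_apply, MonoidHom.inl_apply, MonoidHom.comp_apply, MonoidHom.inl_apply, kV_one_eq_κ, ι𝕎_κ])
    sec hsec hϖ

/-- **THE DEFINITE PLACE, SEVERAL-PLACES FORM.**  For an archimedean Weil datum `ω` over the product junction of
Konno–Konno's real pairs (`(piPhaseHom ε Φ).comp ϖ`, `Φ v = ι𝕎 (P v) (Q v) (R v) (S v)`) and a place `v` where `V` is
definite (`P v` or `Q v` empty), along any continuous section `sec : U(P_v,Q_v) →* G_∞` over
`g ↦ Pi.mulSingle v (g, 1)` there is ONE integer `m` with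
`ω (sec g) (B⁻¹G) = det(g)^m • B⁻¹G` for every `g ∈ U(P_v,Q_v)` and every polynomial `G` free of the place `v`
(and `ω (sec g) h₀ = det(g)^m • h₀`). [cite: KonnoKonno2007, §3.1 (3.1); Folland1989, Prop (4.39);
BrockerTomDieck1985, Ch. II Prop. 8.1] -/
theorem IsArchWeilDatum.exists_forall_place_binvPi_eq_det_zpow_smul
    (ε : ∀ v, ι ≃ DPIdx (P v) (Q v) (R v) (S v)) (ϖ : Gtot →* ∀ v, Ginf (P v) (Q v) (R v) (S v))
    {ω : Representation ℂ Gtot (SchwartzMap (ι × o → ℝ) ℂ)}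
    (hW : IsArchWeilDatum ((piPhaseHom ε fun v => ι𝕎 (P v) (Q v) (R v) (S v)).comp ϖ) ω) (v : o)
    (hVdef : IsEmpty (P v) ∨ IsEmpty (Q v)) (sec : UForm (P v) (Q v) →* Gtot) (hsec : Continuous sec)
    (hϖ : ∀ g, ϖ (sec g) = Pi.mulSingle v ((g, 1) : Ginf (P v) (Q v) (R v) (S v))) :
    ∃ m : ℤ,
      (∀ g : UForm (P v) (Q v),
        ω (sec g) (hermitePi 0) = ((((g : GL (P v ⊕ Q v) ℂ) : Matrix (P v ⊕ Q v) (P v ⊕ Q v) ℂ)).det ^ m) • hermitePi 0) ∧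
      ∀ (g : UForm (P v) (Q v)) (G : MvPolynomial (ι × o) ℂ), (∀ x ∈ G.vars, x.2 ≠ v) →
        ω (sec g) (binvPi G) = ((((g : GL (P v ⊕ Q v) ℂ) : Matrix (P v ⊕ Q v) (P v ⊕ Q v) ℂ)).det ^ m) • binvPi G := by
  obtain ⟨χ, hχ, h0, hG⟩ := hW.exists_character_kV_of_place ε ϖ v (sec.comp (UForm.kV (P v) (Q v)))
    (hsec.comp UForm.continuous_kV) fun k => hϖ (UForm.kV (P v) (Q v) k)
  obtain ⟨e, he⟩ := exists_vacExponents_of_continuous (P := P v) (Q := Q v) (R := R v) (S := S v)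
    (χ.comp (MonoidHom.fst _ _)) (hχ.comp continuous_fst)
  have hχe : ∀ k : Matrix.unitaryGroup (P v) ℂ × Matrix.unitaryGroup (Q v) ℂ,
      ((χ k : Circle) : ℂ) = (k.1 : Matrix (P v) (P v) ℂ).det ^ e.eP * (k.2 : Matrix (Q v) (Q v) ℂ).det ^ e.eQ :=
    fun k => by
      have h1 := he (k, 1)
      rwa [MonoidHom.comp_apply, MonoidHom.coe_fst, vacScalar_mk_one] at h1
  rcases hVdef with hP | hQ
  · refine ⟨e.eQ, fun g => ?_, fun g G hGv => ?_⟩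
    · obtain ⟨k, rfl⟩ := UForm.kV_surjective_of_isEmpty_left (α := P v) (β := Q v) g
      have h1 := h0 k
      rw [MonoidHom.comp_apply] at h1
      rw [h1, hχe, UForm.det_coe_kV, Matrix.det_isEmpty (A := (k.1 : Matrix (P v) (P v) ℂ)), _root_.one_zpow, one_mul,
        one_mul]
    · obtain ⟨k, rfl⟩ := UForm.kV_surjective_of_isEmpty_left (α := P v) (β := Q v) g
      have h1 := hG k G hGv
      rw [MonoidHom.comp_apply] at h1
      rw [h1, hχe, UForm.det_coe_kV, Matrix.det_isEmpty (A := (k.1 : Matrix (P v) (P v) ℂ)), _root_.one_zpow, one_mul,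
        one_mul]
  · refine ⟨e.eP, fun g => ?_, fun g G hGv => ?_⟩
    · obtain ⟨k, rfl⟩ := UForm.kV_surjective_of_isEmpty_right (α := P v) (β := Q v) g
      have h1 := h0 k
      rw [MonoidHom.comp_apply] at h1
      rw [h1, hχe, UForm.det_coe_kV, Matrix.det_isEmpty (A := (k.2 : Matrix (Q v) (Q v) ℂ)), _root_.one_zpow, mul_one,
        mul_one]
    · obtain ⟨k, rfl⟩ := UForm.kV_surjective_of_isEmpty_right (α := P v) (β := Q v) g
      have h1 := hG k G hGv
      rw [MonoidHom.comp_apply] at h1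
      rw [h1, hχe, UForm.det_coe_kV, Matrix.det_isEmpty (A := (k.2 : Matrix (Q v) (Q v) ℂ)), _root_.one_zpow, mul_one,
        mul_one]

end Definite

end Literature.NumberTheory.Weil1964

end
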